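import Summits.RiemannHypothesis.RiemannHypothesis.Theorems.PfPersistenceBarrierTwinsDials
import Literature.NumberTheory.LFunctions.WeilGroundStateRealZerosProofs

/-!
# F3 — FE-honest twins: the extended-Selberg-class members `ζ·(1 + b p^{-s} + p^{1-2s})` — part 1/5: DATUM + STATEMENTS
(the SHAPE-TWIN identity, proved; THEOREM F3-A, PROVED — v2; TEMPERED TRANSFER, PROVED — v3 2026-08-19) — pub-rhpf fake-3

HONEST FRAMING: mechanism/rigidity campaign; no RH claims.  FE-honest wing of the fake programme
(`HOME/FAKES.md §3`).  For a prime `p` and a real `b` the Dirichlet series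
`F_{p,b}(s) = ζ(s)·P_{p,b}(s)`, `P_{p,b}(s) = 1 + b p^{-s} + p^{1-2s} = (1 - α₁ p^{-s})(1 - α₂ p^{-s})`,
satisfies `P(1-s) = p^{2s-1} P(s)`, hence the degree-1 functional equation
`Λ_F(s) := (p²)^{s/2} Γ_ℝ(s) F(s) = Λ_F(1-s)` (conductor `p²`, one simple pole); it lies in the extended
Selberg class `S♯` and violates the Ramanujan / Euler axioms at `p`; its non-`ζ` zeros are those of
`P`: on the critical line iff `|b| ≤ 2√p`, and for `|b| > 2√p` at `1/2 ± η + i(2k + [b>0])π/log p`,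
`η = arccosh(|b|/2√p)/log p` [cite: KaczorowskiPerelli1999, Thm 2 (structure of `S♯` in degree 1)].

Its EXPLICIT-FORMULA DATUM in the tree normalisation of `zetaDatum` (Bombieri 2000 Thm 2) is `ζ`'s
datum plus (i) the conductor term `+ log(p²)·k(0)` in the smooth part and (ii) the extra masses
`w_{P,m} = -s_m (log p) p^{-m/2}` at the positions `± log p^m`, `m ≥ 1`, `s_m = α₁^m + α₂^m` the Newton
sums (`s₀ = 2`, `s₁ = -b`, `s_{m+2} = -b s_{m+1} - p s_m`).  We DECLARE this datum (`sharpLocalDatum`;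
its identification with the L-function is the cited explicit formula, as for `zetaDatum`) and PROVE
the SHAPE-TWIN IDENTITY (FAKES §3.1):

  `a ≤ A`, `2A < log p`, `tsupport g ⊆ [-a, a]`  ⟹  `Q_F(g) = Q_ζ(g) + 2 log p · ‖g‖₂²`

(`sharpLocal_quadratic_eq`, `sharpLocal_quadratic_re_eq`): below `(log p)/2` the Weil form of
`F_{p,b}` is `ζ`'s translated by the constant `2 log p` — same eigenvectors in every Galerkin basis,
spectrum shifted; `ζ` Weil-positive up to `A` makes `F_{p,b}` Weil-positive up to `A`
(`sharpLocal_positivityOn_of_zeta`) although for `|b| > 2√p` it has off-line zeros.  For `p = 29`,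
`(log 29)/2 = 1.6836…` exceeds every served window `a ≤ 1.65` of the observatory.
We also STATE AND PROVE (v2; RULING A25(a)) THEOREM F3-A of FAKES §3.2, the FE-honest variant of fake-5's F5-A
(`F5TailTwins.lean`, `TailDialRayleighBound`): for `(log p)/2 < a < log p` either `ζ` is not
Weil-positive on `[-a, a]`, or the form of a NON-tempered `F_{p,b}` at the explicit translate-pair test
function is `≤ (2ε − (|b|/√p − 2)·log p)·‖g‖₂²` (`SharpLocalRayleighBound`, proved as `sharpLocalRayleighBound`; dichotomy `sharpLocalNegativeOrZetaNotPositive`;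
proof = fake-5's twin-autocorrelation algebra + the parallelogram law for `Re Q_ζ`, plus the single
visible `P`-mass `b log p/√p` at `log p` and the conductor term `2 log p·A_g(0) = 4 log p‖g₁‖₂²`).
v3 adds the PROOF of the TEMPERED TRANSFER `sharpLocalTemperedTransfer` (`|b| ≤ 2√p`:
`ζ` Weil-positive ⇒ `F_{p,b}` Weil-positive): tempered Newton sums `s_m = 2(√p)^m cos(mφ)`, the
`P`-part `2 log p · P_M(f)`, `f(k) = cos(kφ)·A_g(k log p)`, positive-definiteness of `A_g = g ⋆ g̃`
(`re_sum_sum_autocorr_nonneg`) and Fejér summation (`sum_sum_sub_eq_sum_Psum`, `re_Psum_nonneg`).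
Together: an FE-honest `F_{p,b}` is a certified Weil-negative (given `ζ` PSD on the window) iff it is
NON-tempered — door E2 = temperedness, both directions kernel-checked here.

Split of the single staged module `HOME/lean/PFPersistence/F3SharpLocal.lean` v3 (sha16 1e7c8001eda6007d,
1050 lines, `lean check` rc 0 / 0 sorries) into five ≤ 400-line modules for the gate's line lint (REFEREE r10-b):
`…F3SharpLocalDatum` (datum, SHAPE-TWIN identity, the three statements) → `…F3SharpLocalTwin` (generic twin
lemmas) → `…F3SharpLocalBound` (THEOREM F3-A) → `…F3SharpLocalTemperedAux` (Newton sums, prime-term difference,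
PSD autocorrelation, Fejér) → `…F3SharpLocalTempered` (TEMPERED TRANSFER).  Every `def`/`theorem` statement and
proof is verbatim from v3 (v2 3b05073fba483e09 = ADJ A25 add.3 for F3-A); only headers/imports are per-file.
-/

set_option linter.dupNamespace false

noncomputable section

open MeasureTheory Set Filter Complex
open scoped Real Topology

namespace Summit.RiemannHypothesis.RiemannHypothesis.Theorems.PfPersistenceBarrier

open Literature.NumberTheory.LFunctions ExplicitDatum

/-! ### The datum of `ζ · P_{p,b}` -/

/-- Newton sums `s_m = α₁^m + α₂^m` of the roots of `X² + bX + p`: `s₀ = 2`, `s₁ = -b`,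
`s_{m+2} = -b·s_{m+1} - p·s_m`. [folklore] -/
def newtonSum (p : ℕ) (b : ℝ) : ℕ → ℝ
  | 0 => 2
  | 1 => -b
  | m + 2 => -b * newtonSum p b (m + 1) - p * newtonSum p b m

/-- The mass of the local factor `P_{p,b}` at the integer `n`: `-s_m·log p/√n` if `n = p^m` with
`m ≥ 1` (`n ≥ 2`), else `0` — `Λ_P(p^m)·p^{-m/2}` in the normalisation of `zetaDatum`. [folklore] -/
def sharpLocalMass (p : ℕ) (b : ℝ) (n : ℕ) : ℝ :=
  if 2 ≤ n ∧ p ^ Nat.log p n = n then -newtonSum p b (Nat.log p n) * Real.log p / Real.sqrt n else 0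

/-- The explicit-formula datum of `F_{p,b} = ζ·(1 + b p^{-s} + p^{1-2s})` served with its OWN dressing
(conductor `p²`): `ζ`'s smooth part plus `2 log p · k(0)`, `ζ`'s positions `log n`, `ζ`'s masses plus
the `P`-masses. [cite: KaczorowskiPerelli1999, Thm 2 (structure of `S♯` in degree 1)] -/
def sharpLocalDatum (p : ℕ) (b : ℝ) : ExplicitDatum where
  smooth k := zetaDatum.smooth k + 2 * Real.log p * k 0
  pos := zetaDatum.pos
  wt n := zetaDatum.wt n + ((sharpLocalMass p b n : ℝ) : ℂ)

/-- The same masses with `ζ`'s dressing (conductor term dropped): an auxiliary FE-LESS datum which is a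
twin of `ζ` below `log p` in the sense of `AgreeBelow` (it is fake-5's dial `K = 1 + b` at `p` on
windows `< log p`). [folklore] -/
def sharpLocalMassesDatum (p : ℕ) (b : ℝ) : ExplicitDatum where
  smooth := zetaDatum.smooth
  pos := zetaDatum.pos
  wt := (sharpLocalDatum p b).wt

/-- The `P`-mass vanishes at every `n < p` (the powers `p^m`, `m ≥ 1`, are `≥ p`). [folklore] -/
theorem sharpLocalMass_eq_zero_of_lt {p : ℕ} (b : ℝ) {n : ℕ} (hn : n < p) :
    sharpLocalMass p b n = 0 := by
  unfold sharpLocalMass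
  split_ifs with h
  · exfalso
    obtain ⟨h2, hpow⟩ := h
    rw [Nat.log_of_lt hn, pow_zero] at hpow
    omega
  · rfl

/-- **The masses of `F_{p,b}` agree with `ζ`'s below any `B < log p`.** [folklore] -/
theorem zetaDatum_agreeBelow_sharpLocalMassesDatum (p : ℕ) (b : ℝ) {B : ℝ} (hB : B < Real.log p) :
    AgreeBelow zetaDatum (sharpLocalMassesDatum p b) B := by
  intro n
  by_cases hn : n < p
  · refine Or.inr ⟨rfl, ?_⟩
    show zetaDatum.wt n = zetaDatum.wt n + ((sharpLocalMass p b n : ℝ) : ℂ)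
    rw [sharpLocalMass_eq_zero_of_lt b hn]
    simp
  · have hn : p ≤ n := not_lt.mp hn
    have hpos : B < |zetaDatum.pos n| := by
      show B < |Real.log (n : ℝ)|
      have key : Real.log (p : ℝ) ≤ |Real.log (n : ℝ)| := by
        rcases Nat.eq_zero_or_pos p with hp0 | hp0
        · subst hp0; simp
        · exact (Real.log_le_log (by exact_mod_cast hp0) (by exact_mod_cast hn)).trans (le_abs_self _)
      exact lt_of_lt_of_le hB key
    exact Or.inl ⟨Or.inr hpos, Or.inr hpos⟩

/-- The prime terms of the two data coincide (same positions, same masses). [folklore] -/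
theorem sharpLocalDatum_primeTerm (p : ℕ) (b : ℝ) (k : ℝ → ℂ) :
    (sharpLocalDatum p b).primeTerm k = (sharpLocalMassesDatum p b).primeTerm k := rfl

/-- `W_F(k) = W_{masses}(k) + 2 log p · k(0)`: the conductor `p²` enters only through `k(0)`. [folklore] -/
theorem sharpLocalDatum_functional_eq (p : ℕ) (b : ℝ) (k : ℝ → ℂ) :
    (sharpLocalDatum p b).functional k =
      (sharpLocalMassesDatum p b).functional k + 2 * Real.log p * k 0 := by
  simp only [ExplicitDatum.functional, sharpLocalDatum_primeTerm]
  show zetaDatum.smooth k + 2 * Real.log p * k 0 - _ = zetaDatum.smooth k - _ + _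
  ring

/-- **SHAPE-TWIN IDENTITY (FAKES §3.1, PROVED).** On every window `a ≤ A` with `2A < log p`, the Weil
quadratic form of the FE-honest datum `F_{p,b}` equals `ζ`'s plus the constant `2 log p` times
`(g ⋆ g̃)(0) = ‖g‖₂²`. [folklore] -/
theorem sharpLocal_quadratic_eq (p : ℕ) (b : ℝ) {A a : ℝ} (hA : 2 * A < Real.log p) (ha : a ≤ A)
    {g : ℝ → ℂ} (hg : tsupport g ⊆ Icc (-a) a) :
    (sharpLocalDatum p b).quadratic g =
      zetaDatum.quadratic g + 2 * Real.log p * weilConv g (weilReflect g) 0 := by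
  have htwin : (sharpLocalMassesDatum p b).quadratic g = zetaDatum.quadratic g :=
    (quadratic_eq_of_agreeBelow (zetaDatum_agreeBelow_sharpLocalMassesDatum p b hA) rfl ha hg).symm
  unfold ExplicitDatum.quadratic at htwin ⊢
  rw [sharpLocalDatum_functional_eq, htwin]

/-- The same identity on real parts, with `ζ`'s form written as the tree's `weilQuadratic` and
`(g ⋆ g̃)(0) = ∫ ‖g‖²`: `Re Q_F(g) = Re Q_ζ(g) + 2 log p · ‖g‖₂²`. [folklore] -/
theorem sharpLocal_quadratic_re_eq (p : ℕ) (b : ℝ) {A a : ℝ} (hA : 2 * A < Real.log p) (ha : a ≤ A)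
    {g : ℝ → ℂ} (hg : tsupport g ⊆ Icc (-a) a) :
    ((sharpLocalDatum p b).quadratic g).re =
      (weilQuadratic g).re + 2 * Real.log p * ∫ t : ℝ, ‖g t‖ ^ 2 := by
  rw [sharpLocal_quadratic_eq p b hA ha hg, zetaDatum_quadratic, weilConv_weilReflect_apply_zero]
  simp only [Complex.add_re, Complex.mul_re, Complex.ofReal_re, Complex.ofReal_im, mul_zero, sub_zero]
  norm_cast

/-- **Weil positivity of `ζ` up to `A` transfers to `F_{p,b}` up to `A` whenever `2A < log p` and
`p ≥ 1`** — although for `|b| > 2√p` the L-function `F_{p,b}` has off-line zeros: window positivity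
below `(log p)/2` cannot see the prime `p` (FE-honest instance of the locality wall W1). [folklore] -/
theorem sharpLocal_positivityOn_of_zeta {p : ℕ} (hp : 1 ≤ p) (b : ℝ) {A : ℝ}
    (hA : 2 * A < Real.log p) (hζ : zetaDatum.PositivityOn A) :
    (sharpLocalDatum p b).PositivityOn A := by
  intro g hg hsupp
  rw [sharpLocal_quadratic_re_eq p b hA le_rfl hsupp]
  have h1 : 0 ≤ (weilQuadratic g).re := by
    have := hζ g hg hsupp
    rwa [zetaDatum_quadratic] at this
  have h2 : 0 ≤ Real.log p := Real.log_nonneg (by exact_mod_cast hp)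
  have h3 : 0 ≤ ∫ t : ℝ, ‖g t‖ ^ 2 := integral_nonneg fun t ↦ by positivity
  nlinarith

/-! ### THEOREM F3-A (statements; proofs in § "Proof of THEOREM F3-A" below) -/

/-- The F3-A test function: two copies of `g₁` centred at `∓ (log p)/2` with relative sign `sign b`
(so that the single visible `P`-mass at `log p`, of weight `-2 log p·cosh(η log p)·(-sign b)`, is hit
with the unfavourable sign). [folklore] -/
def sharpTwinTest (p : ℕ) (b : ℝ) (g₁ : ℝ → ℂ) : ℝ → ℂ :=
  fun x ↦ g₁ (x + Real.log p / 2) + ((SignType.sign b : ℝ) : ℂ) * g₁ (x - Real.log p / 2)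

/-- THEOREM F3-A, quantitative form (PROVED below: `sharpLocalRayleighBound`): for `|b| > 2√p`, `0 < w`, `2w < log p`, IF `ζ` is
Weil-positive on the window `(log p)/2 + w` and `Re Q_ζ(g₁) ≤ ε‖g₁‖₂²` for a test `g₁` supported in
`[-w, w]`, then the form of `F_{p,b}` at `sharpTwinTest p b g₁` (supported in the window
`(log p)/2 + w`) is at most `(2ε − (|b|/√p − 2) log p)·‖g‖₂²`, `‖g‖₂² = 2‖g₁‖₂²`.  Informal proof
(FAKES §3.2): translation invariance of the autocorrelation, `supp (g₁ ⋆ g̃₁) ⊆ (-log p, log p)` so only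
the mass at `log p` and the conductor see the cross-lag, and `|B_ζ(u,v)| ≤ Q_ζ(g₁)` by Cauchy–Schwarz
for the PSD form; kernel proof below. (A `Prop`, statement only; proved below / in the sibling split files.) -/
def SharpLocalRayleighBound : Prop :=
  ∀ (p : ℕ), p.Prime → ∀ (b w ε : ℝ), 2 * Real.sqrt p < |b| → 0 < w → 2 * w < Real.log p →
    zetaDatum.PositivityOn (Real.log p / 2 + w) →
    ∀ g₁ : ℝ → ℂ, IsWeilTest g₁ → tsupport g₁ ⊆ Icc (-w) w →
      (weilQuadratic g₁).re ≤ ε * ∫ x, ‖g₁ x‖ ^ 2 →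
        ((sharpLocalDatum p b).quadratic (sharpTwinTest p b g₁)).re ≤
          (2 * ε - (|b| / Real.sqrt p - 2) * Real.log p) * (2 * ∫ x, ‖g₁ x‖ ^ 2)

/-- THEOREM F3-A, dichotomy form (PROVED below: `sharpLocalNegativeOrZetaNotPositive`): a NON-tempered FE-honest `F_{p,b}` is Weil-NEGATIVE at
the window `(log p)/2 + w` as soon as `ζ`'s Rayleigh quotient on `[-w, w]` is below
`((|b|/√p − 2) log p)/2` — OR `ζ` itself is not Weil-positive on that window. RH-free. (A `Prop`, statement only; proved below / in the sibling split files.) -/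
def SharpLocalNegativeOrZetaNotPositive : Prop :=
  ∀ (p : ℕ), p.Prime → ∀ (b w ε : ℝ), 2 * Real.sqrt p < |b| → 0 < w → 2 * w < Real.log p →
    ∀ g₁ : ℝ → ℂ, IsWeilTest g₁ → tsupport g₁ ⊆ Icc (-w) w →
      (weilQuadratic g₁).re ≤ ε * ∫ x, ‖g₁ x‖ ^ 2 → 0 < ∫ x, ‖g₁ x‖ ^ 2 →
      2 * ε < (|b| / Real.sqrt p - 2) * Real.log p →
        ¬ zetaDatum.PositivityOn (Real.log p / 2 + w) ∨
          ((sharpLocalDatum p b).quadratic (sharpTwinTest p b g₁)).re < 0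

/-- Sanity: the quantitative form implies the dichotomy (logic + arithmetic). [folklore] -/
theorem sharpLocalNegativeOrZetaNotPositive_of_bound (h : SharpLocalRayleighBound) :
    SharpLocalNegativeOrZetaNotPositive := by
  intro p hp b w ε hb hw hw2 g₁ hg hsupp hq hpos hε
  by_cases hW : zetaDatum.PositivityOn (Real.log p / 2 + w)
  · right
    have hle := h p hp b w ε hb hw hw2 hW g₁ hg hsupp hq
    have hneg : (2 * ε - (|b| / Real.sqrt p - 2) * Real.log p) * (2 * ∫ x, ‖g₁ x‖ ^ 2) < 0 :=
      mul_neg_of_neg_of_pos (by linarith) (by linarith)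
    exact lt_of_le_of_lt hle hneg
  · exact Or.inl hW


/-- TEMPERED TRANSFER (PROVED below: `sharpLocalTemperedTransfer`, v3; FAKES §3.2(c)): for `|b| ≤ 2√p` the
`P`-part of the form (masses `-2 log p cos(mφ)` at `m log p` plus the conductor `2 log p`) is PSD (Fejér
summation of the positive-definite autocorrelation — the kernel proof below replaces 'Poisson summation'), so
`ζ` Weil-positive on EVERY window makes the non-Euler, non-Ramanujan `F_{p,b}` Weil-positive on every
window (and conversely through `W_P ≥ 0` only one way; with Weil's criterion for `F` both are `↔ RH`).
(A `Prop`, statement only; proved below / in the sibling split files.) -/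
def SharpLocalTemperedTransfer : Prop :=
  ∀ (p : ℕ), p.Prime → ∀ b : ℝ, |b| ≤ 2 * Real.sqrt p →
    zetaDatum.Positivity → (sharpLocalDatum p b).Positivity


end Summit.RiemannHypothesis.RiemannHypothesis.Theorems.PfPersistenceBarrier
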